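import Mathlib
import Summits.AtomisticToContinuum.Crystallization.Theses.GappedShellCensus
import Summits.AtomisticToContinuum.Crystallization.Theorems.GappedShellCensusFiveFoldRationingRStubFfrLens
import Summits.AtomisticToContinuum.Crystallization.Theorems.GappedShellCensusFiveFoldRationingRStubFfrCircle
import Summits.AtomisticToContinuum.Crystallization.Theorems.GappedShellCensusFiveFoldRationingRStubFfrCommonLeFive
import Summits.AtomisticToContinuum.Crystallization.Theorems.GappedShellCensusFiveFoldRationingRStubFfrNoFreeSurface
import Summits.AtomisticToContinuum.Crystallization.Theorems.GappedShellCensusFiveFoldRationingRStubFfrRelDense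
import Summits.AtomisticToContinuum.Crystallization.Theorems.GappedShellCensusFiveFoldRationingRStubFfrCounting

/-!
# Crux `GappedShellCensus.FiveFoldRationingR` (stmt-AtomisticToContinuum-18071), line `Sketch` —
# stub `stub_ffrBridge` (the census closes the crux)

The kernel-checked composition of line `Sketch`: the route decl `FiveFoldRationingR` follows from the one
remaining open statement of the line, the LINEAR CENSUS of five-sites (`stub_ffrCensus` of the skeleton
`Cruxes/FiveFoldRationingR/Lines/Sketch.lean`: in an all-gapped-twelve torn-free configuration the sites
carrying a bond with `≥ 5` common partners number `≤ C · r / a` in every ball of radius `r ≥ a`), using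
the six landed stubs:

* `stub_ffrLens` (lens geometry of a bond), `stub_ffrCircle` (planar angular pigeonhole),
* `stub_ffrCommonLeFive` (F1: every bond has `≤ 5` common partners),
* `stub_ffrNoFreeSurface` (torn-free ⇒ some bond partner climbs `≥ 0.18 a` in every direction),
* `stub_ffrRelDense` (every point of space is within `3a` of a site),
* `stub_ffrCounting` (census + relative denseness ⇒ five-ring-free balls of every radius).

Once the census is a theorem `T`, `stub_ffrBridge T : FiveFoldRationingR` closes the item.
-/

noncomputable section

namespace Summit.AtomisticToContinuum.Crystallization.Theorems

open Summit.AtomisticToContinuum.Crystallization.Theses.GappedShellCensus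

/-- **The bridge.** `FiveFoldRationingR` from the linear census of five-sites (hypothesis = the
statement of the skeleton's `stub_ffrCensus`, which receives F1 and `3a`-relative denseness as inputs):
F1 from lens + pigeonhole (A); no free surface from lens + pigeonhole (B) + torn-freeness; relative
denseness from no free surface; then counting. -/
theorem stub_ffrBridge :
    (∀ (Y : Set (EuclideanSpace ℝ (Fin 3))) (a : ℝ), 0 < a → Y.Nonempty →
      (∀ y ∈ Y, ({w ∈ Y | w ≠ y ∧ dist y w ≤ a * (1 + 1 / 50)}.ncard = 12 ∧
        ∀ w ∈ Y, w ≠ y → a * (1 - 1 / 50) ≤ dist y w ∧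
          (dist y w ≤ a * (1 + 1 / 50) ∨ a * (63 / 50) ≤ dist y w))) →
      (∀ y ∈ Y, ∀ v ∈ Y, v ≠ y → dist y v ≤ a * (1 + 1 / 50) →
        4 ≤ {w ∈ Y | w ≠ y ∧ w ≠ v ∧ dist y w ≤ a * (1 + 1 / 50) ∧ dist v w ≤ a * (1 + 1 / 50)}.ncard) →
      (∀ y ∈ Y, ∀ v ∈ Y, v ≠ y → dist y v ≤ a * (1 + 1 / 50) →
        {w ∈ Y | w ≠ y ∧ w ≠ v ∧ dist y w ≤ a * (1 + 1 / 50) ∧ dist v w ≤ a * (1 + 1 / 50)}.ncard ≤ 5) →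
      (∀ p : EuclideanSpace ℝ (Fin 3), ∃ y ∈ Y, dist p y ≤ 3 * a) →
      ∃ C : ℝ, ∀ (p : EuclideanSpace ℝ (Fin 3)) (r : ℝ), a ≤ r →
        (({y ∈ Y | ∃ v ∈ Y, v ≠ y ∧ dist y v ≤ a * (1 + 1 / 50) ∧
            5 ≤ {w ∈ Y | w ≠ y ∧ w ≠ v ∧ dist y w ≤ a * (1 + 1 / 50) ∧
              dist v w ≤ a * (1 + 1 / 50)}.ncard} ∩ Metric.closedBall p r).ncard : ℝ) ≤ C * (r / a)) →
    FiveFoldRationingR := by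
  intro hcensus Y a ha hne hgap htf
  have hF1 := stub_ffrCommonLeFive stub_ffrLens stub_ffrCircle.1 Y a ha hgap
  have hNFS := stub_ffrNoFreeSurface stub_ffrLens stub_ffrCircle.2 Y a ha hgap htf
  have hRD := stub_ffrRelDense Y a ha hne hgap hNFS
  have hC := hcensus Y a ha hne hgap htf hF1 hRD
  exact stub_ffrCounting Y a ha hne hgap hRD hC

end Summit.AtomisticToContinuum.Crystallization.Theorems

end
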